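import Literature.Probability.FitznerVanDerHofstad2017.NobleBoundsN1XSpace
import Literature.Probability.FitznerVanDerHofstad2017.NobleBoundsN1Cls02DoublePrime
import Literature.Probability.FitznerVanDerHofstad2017.NobleBlocksDoublePrimeSupport
import HarnessLib

/-!
# [FvdH17] (6.4)–(6.5) at `N = 1` on the additive family `Ā''` (§6.1-typed row `(0,2)`)

The `''`-twin of `NobleBoundsN1XSpace` and `NobleBoundsN1XSpaceAvg`: the nine class estimates of §6.1 are assembled
into the `x`-space bound (6.4) with the middle element `blockAbar''` of `NobleBlocksDoublePrime` — class `(0,2)` from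
`NobleBoundsN1Cls02DoublePrime.jointWit_cls_zero_two''` (the REPULSIVE triangle `𝓣_{1,1̲,0}` of §6.1 "Case a = 0, b ≥ 2",
arXiv:1506.07977v2 p. 59, l.9918–9922 of the source), the eight classes `(a,b) ≠ (0,2)` from the landed class modules
through `blockAbar''_of_ne` (there `Ā'' = Ā'`) — and summed over `x` into (6.5) on `(Ā''^ι) = matAbarIota''`
(`tsum_le_vecPS_matAbarIota''_vecPE`) and on the class-`1̲`-averaged `Ā''_avg` (`tsum_le_vecPS_matAbarAvg''_vecPE_perc`).
Every statement is the landed `Ā'` statement with `''`, re-proved in the kernel; nothing is inherited from an `Ā'`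
theorem.  No named fact, no numeral, no dimension is fixed; nothing here is a cited hypothesis.
-/

noncomputable section

namespace Literature.Probability.FitznerVanDerHofstad2017

open _root_.MeasureTheory Literature.Barriers.CriticalPhenomena Literature.Probability.Percolation
open Literature.Probability.LatticeModels _root_.SimpleGraph
open Literature.Probability.FitznerVanDerHofstad2017.NobleBlocks
open Literature.Probability.FitznerVanDerHofstad2017.BlockSummation
open scoped ENNReal Matrix

variable {d : ℕ}

/-- **The nine class estimates of §6.1 with the middle element `Ā''`**: class `(0,2)` is
`jointWit_cls_zero_two''` (repulsive `𝓣_{1,1̲,0}`), every other class is its landed `Ā'` estimate (`blockAbar''_of_ne`).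
[cite: FitznerVanDerHofstad2017, §6.1 "Case a = 0 / a = 1 / a ≥ 2" and "b" likewise, Case a = 0, b ≥ 2 (arXiv:1506.07977v2 pp. 58–59)] -/
theorem jointWit_cls'' (p : unitInterval) (x : Site d) (a b : Fin 3) (u v w z t : Site d) :
    ENNReal.ofReal (bondJ d p (v - u)) * piPerc d p 2 (jointWit u v w z t x ∩ clsSet u w t z a b) ≤
      ∑ ι : Fin d × Bool, (if v = u + stepVec ι then (1 : ℝ≥0∞) else 0) *
        (blockPS (Letters.perc d p) a u w * blockAbar'' (Letters.perc d p) ι a b u w t z *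
          blockPE (Letters.perc d p) b (t - x) (z - x)) := by
  by_cases h : a = 0 ∧ b = 2
  · obtain ⟨rfl, rfl⟩ := h
    exact jointWit_cls_zero_two'' p x u v w z t
  · simp_rw [blockAbar''_of_ne _ _ h]
    fin_cases a <;> fin_cases b
    exacts [jointWit_cls_0_0 p x u v w z t, jointWit_cls_0_1 p x u v w z t, jointWit_cls_zero_two p x u v w z t,
      jointWit_cls_1_0 p x u v w z t, jointWit_cls_one_one p x u v w z t, jointWit_cls_1_2 p x u v w z t,
      jointWit_cls_2_0 p x u v w z t, jointWit_cls_two_one p x u v w z t, jointWit_cls_two_two p x u v w z t]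

/-- **[FvdH17] (6.4), the `x`-space bound on `Ξ^{(1)}_p(x)` with the middle element `Ā''`** (bond percolation on
`ℤ^d`, every `p`, every `x`):
`Ξ^{(1)}_p(x) ≤ Σ_{u,w,t,z} Σ_{ι,a,b} P^{S,a}(u,w) Ā''^{ι,a,b}(u,w,t,z) P^{E,b}(t−x,z−x)`.
[cite: FitznerVanDerHofstad2017, §6.1 (6.4) (arXiv:1506.07977v2 p. 58); §6.1 Case a = 0, b ≥ 2 (p. 59)] -/
theorem nobleXiT_one_le_blocks'' (p : unitInterval) (x : Site d) :
    nobleXiT d p 1 x ≤ ∑' u, ∑' w, ∑' t, ∑' z, ∑ ι : Fin d × Bool, ∑ a : Fin 3, ∑ b : Fin 3,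
      blockPS (Letters.perc d p) a u w * blockAbar'' (Letters.perc d p) ι a b u w t z *
        blockPE (Letters.perc d p) b (t - x) (z - x) := by
  refine le_tsum_blocks_of_pointwise (nobleXiT d p 1 x)
    (fun u v w z t => ENNReal.ofReal (bondJ d p (v - u)) * piPerc d p 2 (jointWit u v w z t x))
    (fun ι a b u w t z => blockPS (Letters.perc d p) a u w * blockAbar'' (Letters.perc d p) ι a b u w t z *
      blockPE (Letters.perc d p) b (t - x) (z - x)) (nobleXiT_one_le_tsum_pi_jointWit p x) ?_
  intro u v w z t
  calc ENNReal.ofReal (bondJ d p (v - u)) * piPerc d p 2 (jointWit u v w z t x)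
      ≤ ENNReal.ofReal (bondJ d p (v - u)) * ∑ a, ∑ b, piPerc d p 2 (jointWit u v w z t x ∩ clsSet u w t z a b) :=
        mul_le_mul' le_rfl (measure_le_sum_inter_clsSet _ _ u w t z)
    _ = ∑ a, ∑ b, ENNReal.ofReal (bondJ d p (v - u)) * piPerc d p 2 (jointWit u v w z t x ∩ clsSet u w t z a b) := by
        rw [Finset.mul_sum]; exact Finset.sum_congr rfl fun a _ => Finset.mul_sum _ _ _
    _ ≤ ∑ a, ∑ b, ∑ ι, (if v = u + stepVec ι then (1 : ℝ≥0∞) else 0) *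
          (blockPS (Letters.perc d p) a u w * blockAbar'' (Letters.perc d p) ι a b u w t z *
            blockPE (Letters.perc d p) b (t - x) (z - x)) :=
        Finset.sum_le_sum fun a _ => Finset.sum_le_sum fun b _ => jointWit_cls'' p x a b u v w z t

/-- **[FvdH17] (6.5) = Lemma 5.2, first display, on `(Ā''^ι)`**: `Σ_x Ξ^{(1)}_p(x) ≤ P⃗^S (Ā''^ι) P⃗^E`
(in `[0,∞]`, bond percolation on `ℤ^d`, every `p`).
[cite: FitznerVanDerHofstad2017, Lemma 5.2 first display and §6.1 (6.5) (arXiv:1506.07977v2 pp. 50, 58); §6.1 p. 59] -/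
theorem tsum_nobleXiT_one_le'' (p : unitInterval) :
    ∑' x, nobleXiT d p 1 x ≤
      vecPS (Letters.perc d p) ᵥ* matAbarIota'' (Letters.perc d p) ⬝ᵥ vecPE (Letters.perc d p) :=
  tsum_le_vecPS_matAbarIota''_vecPE (Letters.perc d p) _ (nobleXiT_one_le_blocks'' p)

/-- The same for the real-valued coefficient `Ξ^{(1)}_p(x) = nobleXiN d p 1 x` (`ofReal ∘ toReal ≤ id`).
[cite: FitznerVanDerHofstad2017, Lemma 5.2 first display (arXiv:1506.07977v2 p. 50); §6.1 p. 59] -/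
theorem tsum_ofReal_nobleXiN_one_le'' (p : unitInterval) :
    ∑' x, ENNReal.ofReal (nobleXiN d p 1 x) ≤
      vecPS (Letters.perc d p) ᵥ* matAbarIota'' (Letters.perc d p) ⬝ᵥ vecPE (Letters.perc d p) :=
  tsum_le_vecPS_matAbarIota''_vecPE (Letters.perc d p) _
    fun x => ENNReal.ofReal_toReal_le.trans (nobleXiT_one_le_blocks'' p x)

/-- **[FvdH17] (6.5) at `N = 1`, class-`1̲`-averaged form on `Ā''`**: `Σ_x Ξ^{(1)}_p(x) ≤ P⃗^S ᵥ* Ā''_{avg} ⬝ᵥ P⃗^E`.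
[cite: FitznerVanDerHofstad2017, Lemma 5.2 first display / §6.1 (6.5) with p. 59 "we include the information that … are neighbors" (arXiv:1506.07977v2 pp. 50, 58–59)] -/
theorem tsum_nobleXiT_one_le_avg'' (p : unitInterval) :
    ∑' x, nobleXiT d p 1 x ≤ vecPS (Letters.perc d p) ᵥ*
      matAbarAvg (unitVecs d) (fun a : Fin 3 => decide (a = 1)) (blockAbar'' (Letters.perc d p)) ⬝ᵥ
        vecPE (Letters.perc d p) :=
  tsum_le_vecPS_matAbarAvg''_vecPE_perc p _ (nobleXiT_one_le_blocks'' p)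

/-- The same bound for the real-valued coefficient `Ξ^{(1)}_p = (Ξ^{(1)})^T.toReal`.
[cite: FitznerVanDerHofstad2017, Lemma 5.2 / §6.1 (6.5) with p. 59 (arXiv:1506.07977v2 pp. 50, 58–59)] -/
theorem tsum_ofReal_nobleXiN_one_le_avg'' (p : unitInterval) :
    ∑' x, ENNReal.ofReal (nobleXiN d p 1 x) ≤ vecPS (Letters.perc d p) ᵥ*
      matAbarAvg (unitVecs d) (fun a : Fin 3 => decide (a = 1)) (blockAbar'' (Letters.perc d p)) ⬝ᵥ
        vecPE (Letters.perc d p) :=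
  tsum_le_vecPS_matAbarAvg''_vecPE_perc p _ fun x => ENNReal.ofReal_toReal_le.trans (nobleXiT_one_le_blocks'' p x)

end Literature.Probability.FitznerVanDerHofstad2017

end
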